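import Mathlib.MeasureTheory.Integral.IntervalIntegral.Basic
import Literature.MathematicalPhysics.KineticTheory.Hilbert6Wave0
import Literature.Analysis.FluidPDE.HardSpherePhaseSpace
import Literature.Analysis.FluidPDE.BoltzmannEquation
import HarnessLib

-- provenance: harness21/H21/H21/Statements/Hilbert6/BoltzmannSolutions.lean @ d549e1a (interim HEAD d8f2665); M5 mechanical rewrite
/-!
# Solutions of the Boltzmann equation: notions, DiPerna–Lions, Ukai–Lanford local well-posedness

Family `hilbert6` (trunk FluidKinetic / T-KINETIC, item H6BoltzmannSolutions), statements
**hilbert6.S10**, **hilbert6.S11**, **hilbert6.S13**.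

* **hilbert6.S10** (definition-role): the notions of solution of the Boltzmann equation
  `∂ₜ f + v·∇ₓ f = Q(f, f)` — classical (`Kinetic.IsClassicalBoltzmannSolutionOn`), mild along
  free transport in Lanford's continuous Gaussian-weighted class
  (`Kinetic.IsMildBoltzmannSolutionOn`, `Kinetic.MemLanford`, `Kinetic.ContinuousInLanfordOn`),
  its a.e. variant (`Kinetic.IsAEMildBoltzmannSolutionOn`), and DiPerna–Lions renormalised
  solutions (`Kinetic.IsRenormalisedSolution`). All are defined in the prelude
  `Literature.Prelude.FluidKinetic.BoltzmannEquation`; here we record the characterisation lemma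
  `isMildBoltzmannSolutionOn_iff` and the implication classical ⇒ mild (`classical_isMild`)
  carrying the id.
* **hilbert6.S11** (DiPerna–Lions 1989, Thm 1): global existence of renormalised solutions with
  the entropy inequality for data with finite mass, second moments and entropy, for collision
  kernels satisfying the DiPerna–Lions assumptions (6)–(8) (`IsDiPernaLionsKernel`, defined here).
* **hilbert6.S13** (Ukai 1974; Gallagher–Saint-Raymond–Texier 2013, Thm 5 / Prop. 5.?): local
  well-posedness of the hard-sphere Boltzmann equation on the torus in Lanford's class; the
  existence time depends only on `(β₀, ‖f₀‖_{β₀})` and is the limiting time of Lanford's theorem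
  (hilbert6.S02).

## Sources

* R. DiPerna, P.-L. Lions, *On the Cauchy problem for Boltzmann equations: global existence and
  weak stability*, Ann. Math. 130 (1989) 321–366: assumptions (5)–(8) p. 322, Definition p. 326,
  Theorem 1 p. 322 (with (iii) entropy inequality).
* I. Gallagher, L. Saint-Raymond, B. Texier, *From Newton to Boltzmann: hard spheres and
  short-range potentials* (2013), Def. 2.1 (mild solutions), Thm 5–6, Ch. 5 (continuity
  estimates; theorem/proposition numbers marked `?` are unverified, outline finding 9).
* S. Ukai, *On the existence of global solutions of mixed problem for non-linear Boltzmann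
  equation*, Proc. Japan Acad. 50 (1974) 179–184.

## Mathlib / H21 reuse

Mathlib has no Boltzmann equation, collision kernel or renormalised solution (searched
`Boltzmann`, `collision`, `renormali`, `DiPerna` in Mathlib: nothing relevant). Reused from
Mathlib: `Filter.cocompact`, `Metric.closedBall`, `MeasureTheory.LocallyIntegrable`,
`intervalIntegral`, `UnitAddTorus`, `EuclideanSpace`. Everything kinetic comes from the accepted
preludes (`Kinetic.IsMildBoltzmannSolutionOn`, `Kinetic.IsRenormalisedSolution`,
`Kinetic.HasDiPernaLionsData`, `Kinetic.HasEntropyInequality`, `Kinetic.totalMass`,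
`Kinetic.MemLanford`, `Kinetic.eGaussSupNorm`, `Kinetic.ContinuousInLanfordOn`,
`Kinetic.IsGradCutoffKernel`, `Torus.geometry`, `Euclidean.geometry`, `Hilbert6.hardSphereKernel`,
`Hilbert6.sphereMeasure`).

## Design choices

* Namespace `Literature.Hilbert6` (statement layer); the notions live in `Literature.Kinetic`.
* `IsDiPernaLionsKernel B` is phrased for the H21 kernel type `B : E × E → S^{d-1} → ℝ`
  (`B(v, v_*, ω)`); DiPerna–Lions' `B(z, ω)`, `z = v - v_*`, is recovered as `B(z, 0, ω)` under
  the Galilean (translation) invariance field `sub_right`. Their dependence "only on `|z|` and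
  `|(z, ω)|`" is recorded through the two micro-reversibility symmetries actually used
  (`collide_neg`, `swap_neg`, in the whole-sphere convention of Wave0, exactly as in
  `Kinetic.IsGradCutoffKernel`) — a documented mild generalisation.
* **hilbert6.S11** is stated for positions and velocities in the same finite-dimensional inner
  product space `E` (the setting of `Kinetic.IsRenormalisedSolution`); `E = EuclideanSpace ℝ d`
  is DiPerna–Lions' `ℝ^N`. Generalising costs nothing.
* **hilbert6.S13**: GST work in the scale `X_{β(t)}` with `β(t) = β₀ - λ t`; on the short
  interval `[0, T]` (with `λ T ≤ β₀ / 2`) this class embeds in `C([0,T]; X_{β₀/2})`, in which we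
  state existence and uniqueness. Uniqueness is uniqueness *on `[0, T]`* (values of `f` outside
  `[0, T]` are irrelevant), so it is written as an explicit `∀ g, … → EqOn` clause rather than
  `∃!`.
-/

open MeasureTheory Metric Real Set Filter Topology
open scoped InnerProductSpace ENNReal

namespace Literature.MathematicalPhysics.KineticTheory

noncomputable section

/-! ## hilbert6.S10: notions of solution -/

section Notions

variable {d : Type*} [Fintype d] {X : Type*}

/-- **hilbert6.S10** (notions of solution of the Boltzmann equation `∂ₜ f + v·∇ₓ f = Q(f,f)`;
GST 2013 Def. 2.1 / Thm 6; DiPerna–Lions, Ann. Math. 130 (1989) Def. p. 326).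
Characterisation of the *mild* notion (Duhamel's formula along free transport, GST 2013 §2.1):
`f` is a mild solution on `[0, T]` for the geometry `G` and kernel `B` iff `f ≥ 0` on `[0, T]`
and, for every characteristic `(x, v)` and every `t ∈ [0, T]`, the collision term
`Q_B(f, f)♯(·, x, v)` is integrable on `[0, t]` and
`f♯(t, x, v) = f(0, x, v) + ∫₀ᵗ Q_B(f, f)♯(τ, x, v) dτ`, where `g♯(t, x, v) = g(t, x + t v, v)`
(`Kinetic.alongFlow`).

The other notions of the inventory item are the prelude predicates
* classical `C¹` solutions: `Kinetic.IsClassicalBoltzmannSolutionOn` (see `classical_isMild`);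
* Lanford's class (continuous, `sup_{x,v} e^{β|v|²/2} |f| < ∞`): `Kinetic.MemLanford`,
  `Kinetic.eGaussSupNorm`, `Kinetic.ContinuousInLanfordOn` (GST 2013 Thm 5–6);
* the a.e.-in-`(x, v)` mild notion of DiPerna–Lions / Kaniel–Shinbrot:
  `Kinetic.IsAEMildBoltzmannSolutionOn`;
* DiPerna–Lions renormalised solutions (`β(f) = log (1 + f)`): `Kinetic.IsRenormalisedSolution`. [cite: GST2013, §2.1] -/
theorem isMildBoltzmannSolutionOn_iff (T : ℝ) (G : Literature.Analysis.FluidPDE.Geometry d X)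
    (B : EuclideanSpace ℝ d × EuclideanSpace ℝ d → sphere (0 : EuclideanSpace ℝ d) 1 → ℝ)
    (f : ℝ → X → EuclideanSpace ℝ d → ℝ) :
    Literature.Analysis.FluidPDE.IsMildBoltzmannSolutionOn T G B f ↔
      (∀ t ∈ Icc 0 T, ∀ x v, 0 ≤ f t x v) ∧
      (∀ x v, ∀ t ∈ Icc 0 T, IntervalIntegrable
        (fun τ => Literature.Analysis.FluidPDE.alongFlow G (Literature.Analysis.FluidPDE.collisionTerm B f) τ x v) volume 0 t) ∧
      (∀ x v, ∀ t ∈ Icc 0 T, Literature.Analysis.FluidPDE.alongFlow G f t x v =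
        f 0 x v + ∫ τ in (0 : ℝ)..t, Literature.Analysis.FluidPDE.alongFlow G (Literature.Analysis.FluidPDE.collisionTerm B f) τ x v) :=
  ⟨fun h => ⟨h.nonneg, h.intervalIntegrable, h.duhamel⟩, fun h => ⟨h.1, h.2.1, h.2.2⟩⟩

/-- **hilbert6.S10** (classical ⇒ mild; GST 2013 §2.1, (2.1.1) and Def. 2.1). A classical `C¹`
solution of `∂ₜ f + v·∇ₓ f = Q_B(f, f)` on `[0, T] × ℝ^d × ℝ^d`
(`Kinetic.IsClassicalBoltzmannSolutionOn`, positions in `EuclideanSpace ℝ d`, free transport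
`x + t v` = `Euclidean.geometry d`) is a mild solution on `[0, T]`: integrate
`d/dτ f♯ = Q(f, f)♯` along characteristics. Restates the prelude lemma
`Kinetic.IsClassicalBoltzmannSolutionOn.isMildBoltzmannSolutionOn` with the inventory id. (A
mild solution is in turn an a.e. mild solution in the DiPerna–Lions sense,
`Kinetic.IsMildBoltzmannSolutionOn.isAEMildBoltzmannSolutionOn`.) [cite: GST2013, §2.1  (2.1.1] -/
def classical_isMild : Prop :=
  ∀ {T : ℝ} {B : EuclideanSpace ℝ d × EuclideanSpace ℝ d → sphere (0 : EuclideanSpace ℝ d) 1 → ℝ} {f : ℝ → EuclideanSpace ℝ d → EuclideanSpace ℝ d → ℝ} (hf : Literature.Analysis.FluidPDE.IsClassicalBoltzmannSolutionOn (Icc 0 T) B f),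
    Literature.Analysis.FluidPDE.IsMildBoltzmannSolutionOn T (Literature.Analysis.FluidPDE.Euclidean.geometry d) B f

/- interim proof relied on results that are now named facts (D-0014); demoted to a fact by the M5 import, proof preserved:
:=
  hf.isMildBoltzmannSolutionOn
-/

/-- Classical solutions on `[0, T] × ℝ^d × ℝ^d` are a.e. mild solutions (DiPerna–Lions 1989
p. 322: smooth solutions are mild / renormalised solutions); composition of `classical_isMild`
with `Kinetic.IsMildBoltzmannSolutionOn.isAEMildBoltzmannSolutionOn`. [cite: DiPernaLionsAnnals1989, p. 322: smooth solutions are mild / reno] -/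
def classical_isAEMild : Prop :=
  ∀ {T : ℝ} {B : EuclideanSpace ℝ d × EuclideanSpace ℝ d → sphere (0 : EuclideanSpace ℝ d) 1 → ℝ} {f : ℝ → EuclideanSpace ℝ d → EuclideanSpace ℝ d → ℝ} (hf : Literature.Analysis.FluidPDE.IsClassicalBoltzmannSolutionOn (Icc 0 T) B f),
    Literature.Analysis.FluidPDE.IsAEMildBoltzmannSolutionOn T (Literature.Analysis.FluidPDE.Euclidean.geometry d) B f

/- interim proof relied on results that are now named facts (D-0014); demoted to a fact by the M5 import, proof preserved:
:=
  (classical_isMild hf).isAEMildBoltzmannSolutionOn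
-/

end Notions

/-! ## hilbert6.S11: DiPerna–Lions global renormalised solutions -/

section DiPernaLions

variable {E : Type*} [NormedAddCommGroup E] [InnerProductSpace ℝ E] [FiniteDimensional ℝ E]
  [MeasurableSpace E] [BorelSpace E]

/-- The angular integral `A(z) = ∫_{S^{d-1}} B(z, ω) dω` of a collision kernel at relative
velocity `z = v - v_*`, written for the H21 kernel type as `∫ B((z, 0), ω) dω`
(DiPerna–Lions 1989 p. 322, display after (7)). Bochner integral, junk value `0`. [cite: DiPernaLionsAnnals1989, p. 322  display after (7] -/
def kernelAngularIntegral (B : E × E → sphere (0 : E) 1 → ℝ) (z : E) : ℝ :=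
  ∫ ω, B (z, 0) ω ∂sphereMeasure

/-- *DiPerna–Lions collision kernels* (Ann. Math. 130 (1989) p. 322, assumptions (6)–(8)), for the
H21 kernel type `B(v, v_*, ω)`:
* Galilean invariance: `B` depends on `(v, v_*)` only through `z = v - v_*` (`sub_right`), so
  that DiPerna–Lions' `B(z, ω)` is `B((z, 0), ω)`;
* micro-reversibility (their "`B` depends only on `|z|`, `|(z, ω)|`", (6)), recorded as the two
  symmetries `B(v', v_*', -ω) = B(v, v_*, ω)`, `B(v_*, v, -ω) = B(v, v_*, ω)` in the whole-sphere
  convention of Wave0 (as in `Kinetic.IsGradCutoffKernel`);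
* `B ≥ 0`, `B` measurable and `B ∈ L¹_loc(ℝ^N × S^{N-1})` ((6), (8));
* the mild growth condition (7): for every `R < ∞`,
  `(1 + |v|²)⁻¹ ∫_{|z - v| ≤ R} A(z) dz → 0` as `|v| → ∞`, `A(z) = ∫_{S^{N-1}} B(z, ω) dω`
  (`kernelAngularIntegral`).
Grad cut-off kernels which are Galilean invariant, in particular the hard-sphere kernel, satisfy
these assumptions (`IsDiPernaLionsKernel.of_isGradCutoffKernel`,
`isDiPernaLionsKernel_hardSphereKernel`). [folklore] -/
structure IsDiPernaLionsKernel (B : E × E → sphere (0 : E) 1 → ℝ) : Prop where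
  /-- Joint measurability of `(v, v_*, ω) ↦ B(v, v_*, ω)`. -/
  measurable : Measurable (Function.uncurry B)
  /-- `B ≥ 0` (DL (6)). -/
  nonneg : ∀ p ω, 0 ≤ B p ω
  /-- Galilean invariance: `B(v + u, v_* + u, ω) = B(v, v_*, ω)`. -/
  sub_right : ∀ (v w u : E) ω, B (v + u, w + u) ω = B (v, w) ω
  /-- Micro-reversibility: `B(v', v_*', -ω) = B(v, v_*, ω)`. -/
  collide_neg : ∀ p ω, B (collide ω p) (-ω) = B p ω
  /-- Exchange symmetry: `B(v_*, v, -ω) = B(v, v_*, ω)`. -/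
  swap_neg : ∀ p ω, B p.swap (-ω) = B p ω
  /-- `B ∈ L¹_loc(ℝ^N × S^{N-1})` in the variables `(z, ω)` (DL (6)). -/
  locallyIntegrable : LocallyIntegrable (fun q : E × sphere (0 : E) 1 => B (q.1, 0) q.2)
    (volume.prod sphereMeasure)
  /-- The mild growth condition (DL (7)):
  `(1 + |v|²)⁻¹ ∫_{|z - v| ≤ R} A(z) dz → 0` as `|v| → ∞`, for every `R`. -/
  tendsto_growth : ∀ R : ℝ, Tendsto
    (fun v : E => (1 + ‖v‖ ^ 2)⁻¹ * ∫ z in closedBall v R, kernelAngularIntegral B z)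
    (cocompact E) (𝓝 0)

/-- A Galilean-invariant Grad cut-off kernel (`Kinetic.IsGradCutoffKernel`: measurable, `≥ 0`,
`B ≤ C (1 + |v - v_*|)`, micro-reversible) satisfies the DiPerna–Lions assumptions: `A(z) ≤
C |S^{d-1}| (1 + |z|)`, so `∫_{|z-v| ≤ R} A ≲ R^d (1 + |v| + R) = o(1 + |v|²)`
(DiPerna–Lions 1989 p. 322, remark after (8): "all reasonable kernels with angular cut-off"). [cite: DiPernaLionsAnnals1989, p. 322  remark after (8] -/
def IsDiPernaLionsKernel.of_isGradCutoffKernel : Prop :=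
  ∀ {B : E × E → sphere (0 : E) 1 → ℝ} (hB : Literature.Analysis.FluidPDE.IsGradCutoffKernel B) (hsub : ∀ (v w u : E) ω, B (v + u, w + u) ω = B (v, w) ω),
    IsDiPernaLionsKernel B

/-- The hard-sphere kernel `((v - v_*)·ω)_+` satisfies the DiPerna–Lions assumptions
(DiPerna–Lions 1989 p. 322: hard spheres are the model case of (6)–(8)). [cite: DiPernaLionsAnnals1989, p. 322: hard spheres are the model case] -/
def isDiPernaLionsKernel_hardSphereKernel : Prop :=
  IsDiPernaLionsKernel (hardSphereKernel (E := E))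

/- interim proof relied on results that are now named facts (D-0014); demoted to a fact by the M5 import, proof preserved:
:=
  .of_isGradCutoffKernel Kinetic.isGradCutoffKernel_hardSphereKernel fun v w u ω => by
    simp [hardSphereKernel]
-/

/-- **hilbert6.S11** (DiPerna–Lions, Ann. Math. 130 (1989) Thm 1, p. 322). Let the collision
kernel `B` satisfy the DiPerna–Lions assumptions (6)–(8) (`IsDiPernaLionsKernel`) and let
`f₀ ≥ 0` with `∫∫ f₀ (1 + |x|² + |v|² + |log f₀|) dx dv < ∞` (`Kinetic.HasDiPernaLionsData`).
Then the Boltzmann equation `∂ₜ f + v·∇ₓ f = Q_B(f, f)` on `ℝ^N × ℝ^N` (here: positions and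
velocities in the finite-dimensional inner product space `E`) has a *global renormalised
solution* `f ∈ C([0, ∞); L¹)` (`Kinetic.IsRenormalisedSolution`, Def. p. 326 with
`β(f) = log (1 + f)`) with `f(0) = f₀`, satisfying moreover
`sup_{[0,T]} ∫∫ f (1 + |x|² + |v|² + |log f|) < ∞` for every `T`, conservation of mass
`∫∫ f(t) = ∫∫ f₀`, and the entropy inequality
`H(f(t)) + ∫₀ᵗ ∫ D(f) dx ds ≤ H(f₀)` (`Kinetic.HasEntropyInequality`, Thm 1 (iii)).
Remarks (docstring only): uniqueness of renormalised solutions is open; the kinetic energy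
`∫∫ f |v|²` is only known to satisfy an inequality `≤ ∫∫ f₀ |v|²`, not to be conserved. [cite: DiPernaLionsAnnals1989, Thm. 1 (i)–(iii)] -/
def diperna_lions : Prop :=
  ∀ {B : E × E → sphere (0 : E) 1 → ℝ} (hB : IsDiPernaLionsKernel B) {f₀ : E → E → ℝ} (hf₀ : Literature.Analysis.FluidPDE.HasDiPernaLionsData f₀),
    ∃ f : ℝ → E → E → ℝ, Literature.Analysis.FluidPDE.IsRenormalisedSolution B f ∧ f 0 = f₀ ∧
      (∀ T ≥ (0 : ℝ), ∃ C : ℝ, ∀ t ∈ Icc 0 T,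
        ∫⁻ z : E × E, ENNReal.ofReal (f t z.1 z.2 *
          (1 + ‖z.1‖ ^ 2 + ‖z.2‖ ^ 2 + |log (f t z.1 z.2)|)) ∂(volume.prod volume)
            ≤ ENNReal.ofReal C) ∧
      (∀ t ≥ (0 : ℝ), Literature.Analysis.FluidPDE.totalMass (f t) = Literature.Analysis.FluidPDE.totalMass f₀) ∧
      Literature.Analysis.FluidPDE.HasEntropyInequality B f

end DiPernaLions

/-! ## hilbert6.S13: local well-posedness in Lanford's class (Ukai, GST) -/

section Ukai

variable {d : Type*} [Fintype d]

/-- **hilbert6.S13** (local well-posedness of the hard-sphere Boltzmann equation in Lanford's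
class; Ukai, Proc. Japan Acad. 50 (1974); GST 2013 Thm 5 / Prop. 5.? — numbers unverified).
For every `β₀ > 0` and `K > 0` there is a time `T = T(β₀, K) > 0` such that: for every continuous
initial datum `f₀ ≥ 0` on `T^d × ℝ^d` with `sup_{x,v} e^{β₀|v|²/2} f₀(x, v) ≤ K`
(`Kinetic.MemLanford β₀ f₀`, `Kinetic.eGaussSupNorm β₀ f₀ ≤ K`), the hard-sphere Boltzmann
equation on the unit torus (`Torus.geometry d`, kernel `Hilbert6.hardSphereKernel`) has a mild
solution `f` on `[0, T]` (`Kinetic.IsMildBoltzmannSolutionOn`) with `f(0) = f₀`, continuous in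
time with values in the weighted space `X_{β₀/2}` (`Kinetic.ContinuousInLanfordOn (Icc 0 T)
(β₀/2)`), and `f` is unique on `[0, T]` in this class. The time `T(β₀, K)` — a fraction of the
mean free time `∼ K⁻¹ β₀^{(d+1)/2}` — is exactly the limiting time `T*` of Lanford's theorem
(**hilbert6.S02**, `Statements/Hilbert6/Lanford`). GST prove this in the scale `X_{β₀ - λt}`;
on `[0, T]` with `λ T ≤ β₀/2` that class is contained in `C([0,T]; X_{β₀/2})`. [cite: GST2013, Thm 5 / Prop. 5.? — numbers unverified] -/
def ukai_lanford_lwp : Prop :=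
  ∀ {β₀ : ℝ} (hβ₀ : 0 < β₀) {K : ℝ} (hK : 0 < K),
    ∃ T > (0 : ℝ), ∀ f₀ : UnitAddTorus d → EuclideanSpace ℝ d → ℝ, (∀ x v, 0 ≤ f₀ x v) →
      Literature.Analysis.FluidPDE.MemLanford β₀ f₀ → Literature.Analysis.FluidPDE.eGaussSupNorm β₀ f₀ ≤ ENNReal.ofReal K →
      (∃ f : ℝ → UnitAddTorus d → EuclideanSpace ℝ d → ℝ,
        Literature.Analysis.FluidPDE.ContinuousInLanfordOn (Icc 0 T) (β₀ / 2) f ∧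
        Literature.Analysis.FluidPDE.IsMildBoltzmannSolutionOn T (Literature.Analysis.FluidPDE.Torus.geometry d) hardSphereKernel f ∧ f 0 = f₀) ∧
      (∀ f g : ℝ → UnitAddTorus d → EuclideanSpace ℝ d → ℝ,
        Literature.Analysis.FluidPDE.ContinuousInLanfordOn (Icc 0 T) (β₀ / 2) f →
        Literature.Analysis.FluidPDE.IsMildBoltzmannSolutionOn T (Literature.Analysis.FluidPDE.Torus.geometry d) hardSphereKernel f → f 0 = f₀ →
        Literature.Analysis.FluidPDE.ContinuousInLanfordOn (Icc 0 T) (β₀ / 2) g →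
        Literature.Analysis.FluidPDE.IsMildBoltzmannSolutionOn T (Literature.Analysis.FluidPDE.Torus.geometry d) hardSphereKernel g → g 0 = f₀ →
        EqOn f g (Icc 0 T))

/-- **hilbert6.S13** (propagation of the Gaussian bound, GST 2013 Thm 5 / Prop. 5.?; Ukai 1974):
with `T = T(β₀, K)` as in `ukai_lanford_lwp`, the mild solution moreover obeys the uniform
weighted bound `sup_{t ∈ [0,T]} ‖f(t)‖_{β₀/2} ≤ 2 K` ('?': GST's constant is not verified; any
constant depending only on `(β₀, K)` is what downstream statements consume, so we state
`∃ K'`). [cite: GST2013, Thm 5 / Prop. 5.?] -/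
def ukai_lanford_bound : Prop :=
  ∀ {β₀ : ℝ} (hβ₀ : 0 < β₀) {K : ℝ} (hK : 0 < K),
    ∃ T > (0 : ℝ), ∃ K' : ℝ, ∀ f₀ : UnitAddTorus d → EuclideanSpace ℝ d → ℝ, (∀ x v, 0 ≤ f₀ x v) →
      Literature.Analysis.FluidPDE.MemLanford β₀ f₀ → Literature.Analysis.FluidPDE.eGaussSupNorm β₀ f₀ ≤ ENNReal.ofReal K →
      ∀ f : ℝ → UnitAddTorus d → EuclideanSpace ℝ d → ℝ,
        Literature.Analysis.FluidPDE.ContinuousInLanfordOn (Icc 0 T) (β₀ / 2) f →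
        Literature.Analysis.FluidPDE.IsMildBoltzmannSolutionOn T (Literature.Analysis.FluidPDE.Torus.geometry d) hardSphereKernel f → f 0 = f₀ →
        ∀ t ∈ Icc 0 T, Literature.Analysis.FluidPDE.eGaussSupNorm (β₀ / 2) (f t) ≤ ENNReal.ofReal K'

end Ukai

/-! ## Discharges of the hilbert6.S10 facts (classical ⇒ mild ⇒ a.e. mild) -/

section NotionsProofs

variable {d : Type*} [Fintype d]

/-- Discharge of `classical_isMild` (**hilbert6.S10**, classical ⇒ mild). Source: Gallagher–
Saint-Raymond–Texier, *From Newton to Boltzmann: hard spheres and short-range potentials*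
(EMS Zurich Lectures in Advanced Mathematics, 2013), Part I, Ch. 2, §2.1 "Transport and
collisions", eq. (2.1.1) `∂ₜ f + v·∇ₓ f = Q(f, f)`; the mild formulation is its time-integrated
(Duhamel) form along the free transport `x + t v` (ibid. Part II, Ch. 4–5, "Mild solutions", where
the same integration along the free flow defines mild solutions of the hierarchies). Proof: this
is literally the prelude theorem
`Literature.Analysis.FluidPDE.IsClassicalBoltzmannSolutionOn.isMildBoltzmannSolutionOn_holds`
(method of characteristics: the chain rule within `[0, T]` along `τ ↦ (τ, x + τ v, v)` gives
`d/dτ f♯ = (∂ₜ f + v·∇ₓ f)♯ = Q(f, f)♯`, continuous on `[0, T]` since `f ∈ C¹`, and the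
fundamental theorem of calculus yields `f♯(t) = f(0) + ∫₀ᵗ Q(f, f)♯`). [cite: GST2013, §2.1 (2.1.1)] -/
theorem classical_isMild_holds : classical_isMild (d := d) :=
  fun hf =>
    Literature.Analysis.FluidPDE.IsClassicalBoltzmannSolutionOn.isMildBoltzmannSolutionOn_holds hf

/-- Discharge of `classical_isAEMild`: a classical solution on `[0, T] × ℝ^d × ℝ^d` is a mild
solution (`classical_isMild_holds`), and a pointwise mild solution is an a.e. mild solution
(`Literature.Analysis.FluidPDE.IsMildBoltzmannSolutionOn.isAEMildBoltzmannSolutionOn`), as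
asserted by DiPerna–Lions, Ann. Math. 130 (1989), p. 322 (smooth solutions are mild
solutions). [cite: DiPernaLionsAnnals1989, p. 322] -/
theorem classical_isAEMild_holds : classical_isAEMild (d := d) :=
  fun hf => (classical_isMild_holds hf).isAEMildBoltzmannSolutionOn

end NotionsProofs

end

end Literature.MathematicalPhysics.KineticTheory

/-! ## Discharge of `IsDiPernaLionsKernel.of_isGradCutoffKernel`

DiPerna–Lions, Ann. Math. 130 (1989) p. 322, remark after (8): the assumptions (6)–(8) "are
satisfied by all reasonable kernels with angular cut-off"; Cercignani–Illner–Pulvirenti 1994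
§5.3 Step 3, p. 143, (3.12): "It is easy to check that the collision kernel for hard spheres ...
satisfies (3.12)". The printed argument, for a Grad cut-off kernel `0 ≤ B ≤ C (1 + |v - v_*|)`:
`A(z) = ∫_{S^{d-1}} B(z, ω) dω ≤ C |S^{d-1}| (1 + |z|)`, hence
`∫_{|z - v| ≤ R} A(z) dz ≤ C |S^{d-1}| |B_R| (1 + |v| + R)`, which is `o(1 + |v|²)` as
`|v| → ∞`; local integrability of `B` on `ℝ^N × S^{N-1}` follows from the same pointwise bound
(bounded measurable functions on sets of finite measure are integrable). -/

namespace Literature.MathematicalPhysics.KineticTheory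

section OfGradCutoffProof

variable {E : Type*} [NormedAddCommGroup E] [InnerProductSpace ℝ E] [FiniteDimensional ℝ E]
  [MeasurableSpace E] [BorelSpace E]

/-- The elementary limit behind the growth condition (7) for cut-off kernels:
`(1 + a + t) / (1 + t²) → 0` as `t → ∞` (`a ≥ 0`). [folklore] -/
private theorem tendsto_linear_div_one_add_sq {a : ℝ} (ha : 0 ≤ a) :
    Tendsto (fun t : ℝ => (1 + (t + a)) / (1 + t ^ 2)) atTop (𝓝 0) := by
  refine squeeze_zero' ?_ ?_ ((tendsto_const_nhds (x := 2 + a)).div_atTop tendsto_id)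
  · filter_upwards [eventually_ge_atTop (0 : ℝ)] with t ht
    positivity
  · filter_upwards [eventually_ge_atTop (1 : ℝ)] with t ht
    rw [id, div_le_div_iff₀ (by positivity) (by positivity)]
    nlinarith [mul_nonneg ha (mul_nonneg (by linarith : (0 : ℝ) ≤ t) (by linarith : (0 : ℝ) ≤ t - 1)),
      sq_nonneg (t - 1)]

/-- **Discharge of `IsDiPernaLionsKernel.of_isGradCutoffKernel`** (DiPerna–Lions, Ann. Math. 130
(1989) p. 322, remark after (8); CIP 1994 §5.3 (3.12), p. 143). A Galilean-invariant Grad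
cut-off kernel `0 ≤ B ≤ C (1 + |v - v_*|)` satisfies the DiPerna–Lions assumptions (6)–(8):
measurability, sign and the two micro-reversibility symmetries are part of
`IsGradCutoffKernel`; `B ∈ L¹_loc(dz dω)` because `B` is measurable and bounded by
`C (2 + |z₀|)` on `B̄(z₀, 1) × S^{d-1}`, a set of finite `dz dω`-measure; and for the growth
condition (7), `A(z) ≤ C |S^{d-1}| (1 + |z|)` gives
`|∫_{|z-v| ≤ R} A| ≤ C |S^{d-1}| |B̄_R| (1 + |v| + |R|)`, so that
`(1 + |v|²)⁻¹ ∫_{|z-v| ≤ R} A → 0` as `|v| → ∞`. [cite: DiPernaLionsAnnals1989, p. 322  remark after (8)] -/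
theorem IsDiPernaLionsKernel.of_isGradCutoffKernel_holds :
    IsDiPernaLionsKernel.of_isGradCutoffKernel (E := E) := by
  intro B hB hsub
  haveI : IsFiniteMeasure (sphereMeasure : Measure (sphere (0 : E) 1)) := by
    unfold sphereMeasure; infer_instance
  -- a nonnegative growth constant
  obtain ⟨C, hC⟩ := hB.exists_bound
  set C' : ℝ := max C 0 with hC'
  have hC'0 : 0 ≤ C' := le_max_right _ _
  have hBz : ∀ (z : E) (ω : sphere (0 : E) 1), B (z, 0) ω ≤ C' * (1 + ‖z‖) := fun z ω =>
    calc B (z, 0) ω ≤ C * (1 + ‖z - 0‖) := hC (z, 0) ω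
      _ ≤ C' * (1 + ‖z - 0‖) := mul_le_mul_of_nonneg_right (le_max_left _ _) (by positivity)
      _ = C' * (1 + ‖z‖) := by rw [sub_zero]
  have hnorm : ∀ (z : E) (ω : sphere (0 : E) 1), ‖B (z, 0) ω‖ ≤ C' * (1 + ‖z‖) := fun z ω => by
    rw [Real.norm_of_nonneg (hB.nonneg _ _)]
    exact hBz z ω
  -- measurability of `(z, ω) ↦ B(z, 0, ω)`
  have hmeas : Measurable fun q : E × sphere (0 : E) 1 => B (q.1, 0) q.2 :=
    hB.measurable.comp ((measurable_fst.prodMk measurable_const).prodMk measurable_snd)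
  refine ⟨hB.measurable, hB.nonneg, hsub, hB.collide_neg, hB.swap_neg, ?_, ?_⟩
  · -- local integrability on `E × S^{d-1}`
    intro q₀
    refine ⟨closedBall q₀.1 1 ×ˢ univ, prod_mem_nhds (closedBall_mem_nhds _ one_pos) univ_mem, ?_⟩
    have hs : MeasurableSet (closedBall q₀.1 1 ×ˢ (univ : Set (sphere (0 : E) 1))) :=
      measurableSet_closedBall.prod MeasurableSet.univ
    refine Measure.integrableOn_of_bounded ?_ hmeas.aestronglyMeasurable
      (M := C' * (1 + (‖q₀.1‖ + 1))) ?_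
    · rw [Measure.prod_prod]
      exact ENNReal.mul_ne_top measure_closedBall_lt_top.ne (measure_ne_top _ _)
    · rw [ae_restrict_iff' hs]
      refine ae_of_all _ fun q hq => (hnorm q.1 q.2).trans ?_
      have hq1 : ‖q.1‖ ≤ ‖q₀.1‖ + 1 := by
        have h := (mem_prod.1 hq).1
        rw [mem_closedBall, dist_eq_norm] at h
        calc ‖q.1‖ = ‖q.1 - q₀.1 + q₀.1‖ := by rw [sub_add_cancel]
          _ ≤ ‖q.1 - q₀.1‖ + ‖q₀.1‖ := norm_add_le _ _
          _ ≤ ‖q₀.1‖ + 1 := by linarith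
      gcongr
  · -- the growth condition (7)
    intro R
    set S : ℝ := (sphereMeasure : Measure (sphere (0 : E) 1)).real univ with hS
    set V : ℝ := (volume : Measure E).real (closedBall (0 : E) R) with hV
    have hS0 : 0 ≤ S := measureReal_nonneg
    have hV0 : 0 ≤ V := measureReal_nonneg
    -- `A(z) ≤ C |S^{d-1}| (1 + |z|)`
    have hA : ∀ z : E, ‖kernelAngularIntegral B z‖ ≤ C' * (1 + ‖z‖) * S := fun z =>
      norm_integral_le_of_norm_le_const (Eventually.of_forall fun ω => hnorm z ω)
    -- `|∫_{|z - v| ≤ R} A| ≤ C |S^{d-1}| (1 + |v| + |R|) |B̄_R|`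
    have hI : ∀ v : E, ‖∫ z in closedBall v R, kernelAngularIntegral B z‖ ≤
        C' * (1 + (‖v‖ + |R|)) * S * V := fun v => by
      have h1 : ∀ z ∈ closedBall v R, ‖kernelAngularIntegral B z‖ ≤ C' * (1 + (‖v‖ + |R|)) * S := by
        intro z hz
        refine (hA z).trans ?_
        have hz' : ‖z‖ ≤ ‖v‖ + |R| := by
          rw [mem_closedBall, dist_eq_norm] at hz
          calc ‖z‖ = ‖z - v + v‖ := by rw [sub_add_cancel]
            _ ≤ ‖z - v‖ + ‖v‖ := norm_add_le _ _
            _ ≤ ‖v‖ + |R| := by linarith [le_abs_self R]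
        gcongr
      have h2 := norm_setIntegral_le_of_norm_le_const
        (measure_closedBall_lt_top : (volume : Measure E) (closedBall v R) < ∞) h1
      rwa [Measure.addHaar_real_closedBall_center] at h2
    -- squeeze against `C |S^{d-1}| |B̄_R| (1 + |v| + |R|) / (1 + |v|²) → 0`
    refine squeeze_zero_norm (a := fun v : E => C' * S * V * ((1 + (‖v‖ + |R|)) / (1 + ‖v‖ ^ 2)))
      (fun v => ?_) ?_
    · rw [norm_mul, norm_inv, Real.norm_of_nonneg (by positivity : (0 : ℝ) ≤ 1 + ‖v‖ ^ 2)]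
      calc (1 + ‖v‖ ^ 2)⁻¹ * ‖∫ z in closedBall v R, kernelAngularIntegral B z‖
          ≤ (1 + ‖v‖ ^ 2)⁻¹ * (C' * (1 + (‖v‖ + |R|)) * S * V) :=
            mul_le_mul_of_nonneg_left (hI v) (by positivity)
        _ = C' * S * V * ((1 + (‖v‖ + |R|)) / (1 + ‖v‖ ^ 2)) := by ring
    · rw [← mul_zero (C' * S * V)]
      exact ((tendsto_linear_div_one_add_sq (abs_nonneg R)).comp
        tendsto_norm_cocompact_atTop).const_mul _

/-- **Discharge of `isDiPernaLionsKernel_hardSphereKernel`** (DiPerna–Lions, Ann. Math. 130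
(1989) p. 322: hard spheres are the model case of (6)–(8); CIP 1994 §5.3 p. 143: "the collision
kernel for hard spheres ... satisfies (3.12)"). The hard-sphere kernel `((v - v_*)·ω)_+` is a
Galilean-invariant Grad cut-off kernel (`isGradCutoffKernel_hardSphereKernel`), so
`IsDiPernaLionsKernel.of_isGradCutoffKernel_holds` applies; this is the interim proof preserved
in the comment after `isDiPernaLionsKernel_hardSphereKernel`. [cite: DiPernaLionsAnnals1989, p. 322: hard spheres are the model case] -/
theorem isDiPernaLionsKernel_hardSphereKernel_holds :
    isDiPernaLionsKernel_hardSphereKernel (E := E) :=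
  IsDiPernaLionsKernel.of_isGradCutoffKernel_holds
    Literature.Analysis.FluidPDE.isGradCutoffKernel_hardSphereKernel fun v w u ω => by
      simp only [hardSphereKernel, add_sub_add_right_eq_sub]

end OfGradCutoffProof

end Literature.MathematicalPhysics.KineticTheory
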